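import Mathlib
import Literature.Analysis.FluidPDE.AxisymmetricNoSwirlGlobalHolds
import Literature.Analysis.FluidPDE.KNSSNoAxisymmetricTypeIHolds
import Literature.Analysis.FluidPDE.GigaMiura2011ScaledAlignmentTypeIHolds
import Literature.Analysis.FluidPDE.BarkerPrange2020VorticityAlignmentTypeIHolds
import Literature.Analysis.FluidPDE.LiouvilleExcludesLocalTypeI
import Literature.Analysis.FluidPDE.Seregin2023.TypeIIScenarioExcluded
import Literature.Analysis.FluidPDE.ChaeTypeIIProfileSteadyLimit
import Literature.Analysis.FluidPDE.Seregin2024AxisymTypeIIScenarioHolds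
import Literature.Analysis.FluidPDE.LeiZhang2017SmallSwirlProof
import Literature.Analysis.FluidPDE.Wei2016AprioriHolds
import Literature.Analysis.FluidPDE.LeiZhang2011RegularityHolds
import Literature.Analysis.FluidPDE.KNSSSwirlLiouville
import Literature.Analysis.FluidPDE.KNSSThm53OfWindow
import Literature.Analysis.FluidPDE.NSEssEndpointHolds
import Literature.Analysis.FluidPDE.NSSereginL3BlowupHolds
import Literature.Analysis.FluidPDE.CheskidovShvydkoyRegularProofs
import Literature.Analysis.FluidPDE.NSViscosityRescaling
import Literature.Analysis.FunctionSpaces.WeakLp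
import Literature.Analysis.FluidPDE.PartialRegularityHolds
import Literature.Analysis.FluidPDE.SchefferSingularTimesProofs
import Literature.Analysis.FluidPDE.NSStrongSolutions2DProofs
import Literature.Analysis.FluidPDE.BeltramiFlowLiouville
import Literature.Analysis.FluidPDE.NearBeltramiEnstrophyCriterion
import HarnessLib

/-!
# RowF1b

Topic `Literature/Uncategorized`. Named literature fact(s) relocated by the gate from `Summits/NavierStokesRegularity/NavierStokesRegularity/Theorems/ScenarioCensusForward.lean`
(accept-time relocation of `[cite]`d propositions written inline in a Summits proposal; human ruling 2026-08-15).
Sources: BarkerPrange2020Alignment, CaffarelliKohnNirenberg1982, Chae2010, ChaeWolf2016, EscauriazaSereginSverak2003, FarhatGrujic2018, FoiasManleyRosaTemam2001, GigaMiura2011, KochNadirashviliSereginSverak2009, LeiZhang2017, LemarieRieusset2016, Nadirashvili2014, Seregin2012, Seregin2024AxisymTypeII, Seregin2026.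

* `Literature.Uncategorized.Row_F10`
* `Literature.Uncategorized.Row_F14`
* `Literature.Uncategorized.Row_F14'`
* `Literature.Uncategorized.Row_F1b`
* `Literature.Uncategorized.Row_F1c`
* `Literature.Uncategorized.Row_F2`
* `Literature.Uncategorized.Row_F3`
* `Literature.Uncategorized.Row_F4a`
* `Literature.Uncategorized.Row_F4b`
* `Literature.Uncategorized.Row_F5a`
* `Literature.Uncategorized.Row_F5b`
* `Literature.Uncategorized.Row_F6`
* `Literature.Uncategorized.Row_F9`
-/

namespace Literature.Uncategorized

open Set Function Filter Topology MeasureTheory Metric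
open scoped NNReal ENNReal ContDiff
open Literature.Analysis Literature.Analysis.FluidPDE Literature.Analysis.FunctionSpaces

/-- **Row F1b** (Type I + continuous vorticity direction, Giga–Miura): ALIAS of the fact
`gigaMiura_continuousAlignment_typeI`, PROVED.  EXCLUDED-IN-TREE. [cite: GigaMiura2011, Thm 1.2] -/
def Row_F1b : Prop := gigaMiura_continuousAlignment_typeI

/-- **Row F1c** (Type I + concentrating vorticity alignment, Barker–Prange 2020 Thm 3): ALIAS of
`barkerPrange2020_alignment_concentrating_typeI`, PROVED.  EXCLUDED-IN-TREE.
[cite: BarkerPrange2020Alignment, Thm. 3 (arXiv:1906.08225 §5.2)] -/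
def Row_F1c : Prop := barkerPrange2020_alignment_concentrating_typeI

/-- **Row F2** (Type I, or `r‖u‖ ≤ C` · axisymmetric, swirl allowed · Clay class, bounded on closed
sub-strips): such a solution extends past `T` — ALIAS of `knss_no_axisymmetric_typeI` (KNSS 2009
Thms 6.1–6.2; Seregin–Šverák 2009), PROVED.  EXCLUDED-IN-TREE ("every axisymmetric singularity is
Type II"). [cite: KochNadirashviliSereginSverak2009, Thms 6.1–6.2 (arXiv:0709.3599 pp. 11–12)] -/
def Row_F2 : Prop := knss_no_axisymmetric_typeI

/-- **Row F3** (I∨II · axisymmetric without swirl · smooth decaying data): global regularity —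
ALIAS of `axisymmetric_no_swirl_global_regularity` (Ladyzhenskaya / Ukhovskii–Yudovich 1968), PROVED.
EXCLUDED-IN-TREE. [cite: LemarieRieusset2016, Thm 10.4 (p. 285)] -/
def Row_F3 : Prop := axisymmetric_no_swirl_global_regularity

/-- **Row F4a** (Type II, Seregin's weighted-energy concentration scenario with CONTINUOUS weight):
ALIAS of `Seregin2023.seregin2026_typeII_scenario_excluded_continuousWeight`, PROVED (the
letter-of-source constant-weight form is refuted in tree and NOT cited).  EXCLUDED-IN-TREE.
[cite: Seregin2026, Thm 2.1 (p. 5)] -/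
def Row_F4a : Prop := Seregin2023.seregin2026_typeII_scenario_excluded_continuousWeight

/-- **Row F4b** (Type II, asymptotically self-similar with `L^p`-convergent profile, `3 < p ≤ 9/2`;
Chae 2010 Thm 1.4): the profile `V` vanishes a.e.  The statement of the tree theorem
`chae2010_typeII_asymptoticallySelfSimilar_of_le_nineHalves`.  EXCLUDED-IN-TREE (`p > 9/2`: row
F4b′, fact `chae2010_typeII_asymptoticallySelfSimilar` without `_holds`).
[cite: Chae2010, Thm 1.4 (= arXiv:0711.1113 Thm 3.1)] -/
def Row_F4b : Prop :=
  ∀ (T : ℝ), 0 < T → ∀ (p : ℝ≥0), 3 < p → (p : ℝ≥0∞) ≤ 9 / 2 →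
    ∀ (v : ℝ → EuclideanSpace ℝ (Fin 3) → EuclideanSpace ℝ (Fin 3))
      (π : ℝ → EuclideanSpace ℝ (Fin 3) → ℝ),
    IsClassicalNSSolutionOn (Ioo 0 T) 1 0 v π → ContinuousInLpOn (Ico 0 T) p v →
    ∀ (γ : ℝ), 1 < γ → ∀ (V : EuclideanSpace ℝ (Fin 3) → EuclideanSpace ℝ (Fin 3)),
    MemLp V (p : ℝ≥0∞) volume → Tendsto (chaeTypeIIDeviation T γ p v V) (𝓝[<] T) (𝓝 0) →
    eWeakGradL2Sq V < ⊤ → V =ᵐ[volume] 0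

/-- **Row F5a** (Type II, axisymmetric power-concentration scenario; Seregin 2024 Prop 2.3 /
Cor 2.4): ALIAS of the conjunction of `seregin2024_axisym_typeII_scenario_excluded_Lq` and
`…_vorticity`, both PROVED.  EXCLUDED-IN-TREE. [cite: Seregin2024AxisymTypeII, Prop 2.3 and Cor 2.4 (§2 p. 7)] -/
def Row_F5a : Prop :=
  seregin2024_axisym_typeII_scenario_excluded_Lq ∧ seregin2024_axisym_typeII_scenario_excluded_vorticity

/-- **Row F5b** (axisymmetric regularity CRITERIA inside F5: small swirl, log modulus of the swirl,
`BMO⁻¹` stream function, KNSS's bounded-weak swirl form): ALIAS of the conjunction of the four facts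
`LeiZhang2017_smallSwirl_regularity`, `LeiZhang2017_logModulus_regularity`,
`LeiZhang2011_regularity_bmoStream`, `KNSS2009_regularity_axisymmetric_swirl`, all PROVED.
EXCLUDED-IN-TREE (criteria). [cite: LeiZhang2017, Thm 1.1 and Cor 1.3] -/
def Row_F5b : Prop :=
  LeiZhang2017_smallSwirl_regularity ∧ LeiZhang2017_logModulus_regularity ∧
    LeiZhang2011_regularity_bmoStream ∧ KNSS2009_regularity_axisymmetric_swirl

/-- **Row F6** (I∨II · no symmetry · `L^∞_t L³_x` / Ladyzhenskaya–Prodi–Serrin classes): critical-norm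
blow-up is necessary — ALIAS of `ess_endpoint ∧ seregin_L3_blowup ∧ ladyzhenskaya_prodi_serrin`
(ESS 2003 Thms 1.3–1.4; Seregin 2012 Thm 1.1: `‖u(t)‖₃ → ∞`; LPS), all PROVED.  EXCLUDED-IN-TREE.
[cite: EscauriazaSereginSverak2003, Thms. 1.3–1.4] [cite: Seregin2012, Thm. 1.1] -/
def Row_F6 : Prop := ess_endpoint ∧ seregin_L3_blowup ∧ ladyzhenskaya_prodi_serrin

/-- **Row F9** (I∨II · suitable weak class · "fat" singular sets): `𝒫¹(Σ) = 0` (CKN 1982) and the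
singular times are `ℋ^{1/2}`-null (Leray / Scheffer) — ALIAS of
`ckn_partial_regularity ∧ scheffer_singular_times`, both PROVED.  EXCLUDED-IN-TREE.
[cite: CaffarelliKohnNirenberg1982, Thm B] -/
def Row_F9 : Prop := ckn_partial_regularity ∧ scheffer_singular_times

/-- **Row F10** (I∨II · planar 2D · `𝕋²`): global strong solutions (Foias–Manley–Rosa–Temam) —
ALIAS of `fmrt_strong_existence_torus2`, PROVED.  EXCLUDED-IN-TREE (`ℝ²`: row F10′, print only).
[cite: FoiasManleyRosaTemam2001, Thm 7.4 (Ch. II)] -/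
def Row_F10 : Prop := fmrt_strong_existence_torus2

/-- **Row F14** (exactly Beltrami datum `curl u₀ = λ(x) u₀` on `ℝ³` with finite energy · VACUOUS): a
`C¹` divergence-free (generalised) Beltrami field in `L²(ℝ³)` vanishes identically (Nadirashvili 2014
/ Chae–Wolf 2016 Rem. 1.4 (ii), `q = 2`), so the cell is empty — the tree theorem
`IsBeltrami.eq_zero_of_integrable_norm_rpow`.  EXCLUDED-IN-TREE (vacuous).
[cite: ChaeWolf2016, Remark 1.4 (ii)] [cite: Nadirashvili2014, Theorem] -/
def Row_F14 : Prop :=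
  ∀ (v : EuclideanSpace ℝ (Fin 3) → EuclideanSpace ℝ (Fin 3)) (lam : EuclideanSpace ℝ (Fin 3) → ℝ),
    IsBeltrami v lam → ContDiff ℝ 1 v → VectorCalculus.IsDivFree v →
    Integrable (fun x : EuclideanSpace ℝ (Fin 3) => ‖v x‖ ^ (2 : ℝ)) → v = 0

/-- **Row F14′** (I∨II · (near-)Beltrami · Beale–Kato–Majda class `HasBoundedSobolevNormsOn` on closed
sub-strips): depleted Lamb vector `‖u × ω‖ ≤ a(t)‖u‖‖ω‖` with `a(t)‖∇u(t)‖₂^{1/2} ≤ c` on `[0,T)` ⇒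
continuation in the class past `T` (`HasSobolevExtensionPast`) — the statement of the tree theorem
`nearBeltrami_enstrophy_criterion` (Farhat–Grujić 2018 Thm 1, whole-space form).  EXCLUDED-IN-TREE
(criterion; `𝕋³` twins `Torus.classicalNS_global_stability_of_beltrami_three` etc. by name).
[cite: FarhatGrujic2018, Thm 1 (p. 4)] -/
def Row_F14' : Prop :=
  ∀ (ν T c : ℝ), 0 < ν → 0 < T →
    ∀ (u : ℝ → EuclideanSpace ℝ (Fin 3) → EuclideanSpace ℝ (Fin 3))
      (p : ℝ → EuclideanSpace ℝ (Fin 3) → ℝ) (a : ℝ → ℝ),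
    IsClassicalNSSolutionOn (Ico 0 T) ν 0 u p → (∀ T'' < T, HasBoundedSobolevNormsOn (Icc 0 T'') u) →
    (∀ t ∈ Ico 0 T, 0 ≤ a t) →
    (∀ t ∈ Ico 0 T, ∀ x, ‖cross (u t x) (curl (u t) x)‖ ≤ a t * (‖u t x‖ * ‖curl (u t) x‖)) →
    (∀ t ∈ Ico 0 T, a t * Real.sqrt (Real.sqrt (∫ x, frobeniusNormSq (fderiv ℝ (u t) x))) ≤ c) →
    HasSobolevExtensionPast ν u T

/-! ## Discharges (appended 2026-08-28)

Every `Row_*` fact of this relocated module is a theorem of the tree: the aliases are fed the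
`_holds` theorems of the aliased facts, and the three statement-shaped rows (`Row_F4b`, `Row_F14`,
`Row_F14'`) are the statements of the tree theorems named in their docstrings.  The proof terms are
the ones of `row_F*_excluded` in
`Summits/NavierStokesRegularity/NavierStokesRegularity/Theorems/ScenarioCensusForward.lean`. -/

/-- Row F1b is a theorem of the tree. [cite: GigaMiura2011, Thm 1.2] -/
theorem Row_F1b_holds : Row_F1b := gigaMiura_continuousAlignment_typeI_holds

/-- Row F1c is a theorem of the tree. [cite: BarkerPrange2020Alignment, Thm. 3 (arXiv:1906.08225 §5.2)] -/
theorem Row_F1c_holds : Row_F1c := barkerPrange2020_alignment_concentrating_typeI_holds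

/-- Row F2 is a theorem of the tree. [cite: KochNadirashviliSereginSverak2009, Thms 6.1–6.2 (arXiv:0709.3599 pp. 11–12)] -/
theorem Row_F2_holds : Row_F2 := knss_no_axisymmetric_typeI_holds

/-- Row F3 is a theorem of the tree. [cite: LemarieRieusset2016, Thm 10.4 (p. 285)] -/
theorem Row_F3_holds : Row_F3 := axisymmetric_no_swirl_global_regularity_holds

/-- Row F4a is a theorem of the tree. [cite: Seregin2026, Thm 2.1 (p. 5)] -/
theorem Row_F4a_holds : Row_F4a :=
  Seregin2023.seregin2026_typeII_scenario_excluded_continuousWeight_holds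

/-- Row F4b is a theorem of the tree. [cite: Chae2010, Thm 1.4 (= arXiv:0711.1113 Thm 3.1)] -/
theorem Row_F4b_holds : Row_F4b := fun _ hT _ hp3 hp92 _ _ hv hvc _ hγ _ hV hconv hH1 =>
  chae2010_typeII_asymptoticallySelfSimilar_of_le_nineHalves hT hp3 hp92 hv hvc hγ hV hconv hH1

/-- Row F5a is a theorem of the tree. [cite: Seregin2024AxisymTypeII, Prop 2.3 and Cor 2.4 (§2 p. 7)] -/
theorem Row_F5a_holds : Row_F5a :=
  ⟨seregin2024_axisym_typeII_scenario_excluded_Lq_holds,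
    seregin2024_axisym_typeII_scenario_excluded_vorticity_holds⟩

/-- Row F5b is a theorem of the tree. [cite: LeiZhang2017, Thm 1.1 and Cor 1.3] -/
theorem Row_F5b_holds : Row_F5b :=
  ⟨LeiZhang2017_smallSwirl_regularity_holds, LeiZhang2017_logModulus_regularity_holds,
    LeiZhang2011_regularity_bmoStream_holds, KNSS2009_regularity_axisymmetric_swirl_holds⟩

/-- Row F6 is a theorem of the tree. [cite: EscauriazaSereginSverak2003, Thms. 1.3–1.4] [cite: Seregin2012, Thm. 1.1] -/
theorem Row_F6_holds : Row_F6 :=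
  ⟨ess_endpoint_holds, seregin_L3_blowup_holds, ladyzhenskaya_prodi_serrin_holds⟩

/-- Row F9 is a theorem of the tree. [cite: CaffarelliKohnNirenberg1982, Thm B] -/
theorem Row_F9_holds : Row_F9 := ⟨ckn_partial_regularity_holds, scheffer_singular_times_holds⟩

/-- Row F10 is a theorem of the tree. [cite: FoiasManleyRosaTemam2001, Thm 7.4 (Ch. II)] -/
theorem Row_F10_holds : Row_F10 := fmrt_strong_existence_torus2_holds

/-- Row F14 is a theorem of the tree (`q = 2`). [cite: ChaeWolf2016, Remark 1.4 (ii)] [cite: Nadirashvili2014, Theorem] -/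
theorem Row_F14_holds : Row_F14 := fun _ _ h hv hdiv hint =>
  h.eq_zero_of_integrable_norm_rpow hv hdiv le_rfl (by norm_num) hint

/-- Row F14′ is a theorem of the tree. [cite: FarhatGrujic2018, Thm 1 (p. 4)] -/
theorem Row_F14'_holds : Row_F14' := fun _ _ _ hν hT _ _ _ hsol hreg ha hang hcpl =>
  nearBeltrami_enstrophy_criterion hν hT hsol hreg ha hang hcpl

end Literature.Uncategorized
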